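/-
Copyright (c) 2026 the pub-hodgecm-mathlib formalisation cell (harness21).  Prover seat hodgecm-mathlib-K2E3-p25 (g3) (architect chair (nsc-S-A′)), HCML Track B «K2-LIT» ∕ h413
(`stmt-HodgeConjecture-24833`), leaf (nsc-S-A′), case brick C1′ (`sig_K2E3GL3SAprimeC1low`): file L1 = IRR♭-a, the exponents of `D♭ = D(η, ην½⁻¹) = Ind_Q(η∘det₂ ⊗ ην^(-1∕2))` read off ★ GEO-QB
— the MIRROR of ★ IRR″-a `K2E3GL3OneLinkNestedHighPieces` (K2E3-p17 (g8)).  2026-09-04.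
-/
import Summits.HodgeConjecture.HodgeConjecture.Theorems.K2E3GL3StandardModuleJacquetDimension   -- ★ GEO-QB (K2E5-p17): `finrank_weightSpace_normalizedJacquetGL_D`
import Summits.HodgeConjecture.HodgeConjecture.Theorems.K2E3GL3PrincipalSeriesRegular           -- ★ REG (K2E3-p23): `eq_of_tch_coe_eq`, `mul_nuHalf_inv_ne_mul_nuHalf`
import Summits.HodgeConjecture.HodgeConjecture.Theorems.K2E3GL3OneLinkNestedHighPieces          -- ★ IRR″-a (K2E3-p17 g8): `tch_reorder_eq` (reused), the letters `a = ην½⁻¹`, `aν = ην½`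
import HarnessLib

/-!
# Crux `H413` — leaf (nsc-S-A′), case C1′ «ONE LINK, NESTED LOW» (support `{a, a, aν}`), brick IRR♭-a: THE EXPONENTS OF `D♭ = D(η, ην½⁻¹)` — `E(D♭) = {B², A}`

Cell `hodgecm-mathlib`, Track B; THEOREMS ONLY; count-neutral helper (`--supports stmt-HodgeConjecture-24833 --as helper`).  Letters (C1′, support `{a, a, aν}`, `a = ην½⁻¹`,
`aν = ην½`, as in the C1″ files): weights `A = tch(a, aν, a)` (the inducing vector `θ_{D♭}`, so `D♭ ↪ I(A)` by ★ STD-EMB), `B = tch(a, a, aν)`, `C = tch(aν, a, a)`; `D♭` = ★ STD-EMB's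
`D η (ην½⁻¹)` spelled `parabolicIndGL F ![f,f,t] (𝟙.twist ψ_Q)`.  ★ GEO-QB's count `mult (D η ψ) ζ = #{w ∈ {1, s₂, s₁s₂} : ζ = tch(θ_D ∘ w⁻¹)}` at `ψ = ην½⁻¹` (`θ_D = (a, aν, a)`:
`w = 1 ↦ A`, `w = s₂, s₁s₂ ↦ B`): **`finrank_weightSpace_D_low (hη) (ζ) : r_U(D♭) f.d. ∧ mult D♭ ζ = 2·[ζ = B] + [ζ = A]`**, plus `tch_B_ne_A`, `reorder_theta_D_low`.  Input of the C1′ mirror files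
L2 `K2E3GL3OneLinkNestedLowAmbient`, L3 `…LowQuotient`, L4 `…NestedLow` (architect K2E3-p25 (g3) 2026-09-04 14:5xZ; role map (X, Y, Z; D″, S₀) ↦ (B, A, C; D♭, S♭)).

HONEST LABEL: HC_CM is proved only modulo the 7 printed citations (2 remaining named inputs: hLiu418 = stmt-HodgeConjecture-24832, h413 =
stmt-HodgeConjecture-24833) until rung 0 closes; count-neutral helper.

## References
* [BernsteinZelevinsky1977] I. N. Bernstein, A. V. Zelevinsky, *Induced representations of reductive p-adic groups I*, Ann. Sci. ÉNS 10 (1977), §2.12, Thm. 5.2.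
* [Zelevinsky1980] A. V. Zelevinsky, *Induced representations of reductive p-adic groups II*, Ann. Sci. ÉNS 13 (1980), §1.2, §1.6, Ex. 3.2.
-/

set_option autoImplicit false
-- the mandated namespace repeats `HodgeConjecture.HodgeConjecture`, as in every `Theorems/*.lean` of this sub-problem
set_option linter.dupNamespace false

noncomputable section

open Module Representation Literature.NumberTheory.Automorphic Literature.NumberTheory.GaloisRepresentations.IsNonarchimedeanLocalField
open scoped MatrixGroups NNReal
open Summit.HodgeConjecture.HodgeConjecture.Cruxes.H413.K2E3GL3StandardModuleJacquetDimension (finrank_weightSpace_normalizedJacquetGL_D)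
open Summit.HodgeConjecture.HodgeConjecture.Cruxes.H413.K2E3GL3PrincipalSeriesRegular (eq_of_tch_coe_eq mul_nuHalf_inv_ne_mul_nuHalf)
open Summit.HodgeConjecture.HodgeConjecture.Cruxes.H413.K2E3GL3OneLinkNestedHighPieces (tch_reorder_eq)

namespace Summit.HodgeConjecture.HodgeConjecture.Cruxes.H413.K2E3GL3OneLinkNestedLowPieces

variable {F : Type} [Field F] [ValuativeRel F] [TopologicalSpace F] [IsNonarchimedeanLocalField F] (η : Fˣ →* ℂˣ)

/-- The three reorderings of `θ_{D♭} = (a, aν, a)`: `w = 1 ↦ (a,aν,a) = A`, `w = s₂ ↦ (a,a,aν) = B`, `w = s₁s₂ ↦ (a,a,aν) = B`. [folklore] -/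
theorem reorder_theta_D_low :
    (![(![(η * ((unramifiedTwist F (1 / 2) : QuasiChar F).toMonoidHom)⁻¹), (η * ((unramifiedTwist F (1 / 2) : QuasiChar F).toMonoidHom)), (η * ((unramifiedTwist F (1 / 2) : QuasiChar F).toMonoidHom)⁻¹)] : Fin 3 → (Fˣ →* ℂˣ)) ((1 : Equiv.Perm (Fin 3)).symm 0), (![(η * ((unramifiedTwist F (1 / 2) : QuasiChar F).toMonoidHom)⁻¹), (η * ((unramifiedTwist F (1 / 2) : QuasiChar F).toMonoidHom)), (η * ((unramifiedTwist F (1 / 2) : QuasiChar F).toMonoidHom)⁻¹)] : Fin 3 → (Fˣ →* ℂˣ)) ((1 : Equiv.Perm (Fin 3)).symm 1), (![(η * ((unramifiedTwist F (1 / 2) : QuasiChar F).toMonoidHom)⁻¹), (η * ((unramifiedTwist F (1 / 2) : QuasiChar F).toMonoidHom)), (η * ((unramifiedTwist F (1 / 2) : QuasiChar F).toMonoidHom)⁻¹)] : Fin 3 → (Fˣ →* ℂˣ)) ((1 : Equiv.Perm (Fin 3)).symm 2)] = (![(η * ((unramifiedTwist F (1 / 2) : QuasiChar F).toMonoidHom)⁻¹),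 (η * ((unramifiedTwist F (1 / 2) : QuasiChar F).toMonoidHom)), (η * ((unramifiedTwist F (1 / 2) : QuasiChar F).toMonoidHom)⁻¹)] : Fin 3 → (Fˣ →* ℂˣ))) ∧
    (![(![(η * ((unramifiedTwist F (1 / 2) : QuasiChar F).toMonoidHom)⁻¹), (η * ((unramifiedTwist F (1 / 2) : QuasiChar F).toMonoidHom)), (η * ((unramifiedTwist F (1 / 2) : QuasiChar F).toMonoidHom)⁻¹)] : Fin 3 → (Fˣ →* ℂˣ)) ((Equiv.swap (1 : Fin 3) 2).symm 0), (![(η * ((unramifiedTwist F (1 / 2) : QuasiChar F).toMonoidHom)⁻¹), (η * ((unramifiedTwist F (1 / 2) : QuasiChar F).toMonoidHom)), (η * ((unramifiedTwist F (1 / 2) : QuasiChar F).toMonoidHom)⁻¹)] : Fin 3 → (Fˣ →* ℂˣ)) ((Equiv.swap (1 : Fin 3) 2).symm 1), (![(η * ((unramifiedTwist F (1 / 2) : QuasiChar F).toMonoidHom)⁻¹), (η * ((unramifiedTwist F (1 / 2) : QuasiChar F).toMonoidHom)), (η * ((unramifiedTwist F (1 / 2) : QuasiChar F).toMonoidHom)⁻¹)]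 : Fin 3 → (Fˣ →* ℂˣ)) ((Equiv.swap (1 : Fin 3) 2).symm 2)] = (![(η * ((unramifiedTwist F (1 / 2) : QuasiChar F).toMonoidHom)⁻¹), (η * ((unramifiedTwist F (1 / 2) : QuasiChar F).toMonoidHom)⁻¹), (η * ((unramifiedTwist F (1 / 2) : QuasiChar F).toMonoidHom))] : Fin 3 → (Fˣ →* ℂˣ))) ∧
    (![(![(η * ((unramifiedTwist F (1 / 2) : QuasiChar F).toMonoidHom)⁻¹), (η * ((unramifiedTwist F (1 / 2) : QuasiChar F).toMonoidHom)), (η * ((unramifiedTwist F (1 / 2) : QuasiChar F).toMonoidHom)⁻¹)] : Fin 3 → (Fˣ →* ℂˣ)) ((Equiv.swap (0 : Fin 3) 1 * Equiv.swap (1 : Fin 3) 2).symm 0), (![(η * ((unramifiedTwist F (1 / 2) : QuasiChar F).toMonoidHom)⁻¹), (η * ((unramifiedTwist F (1 / 2) : QuasiChar F).toMonoidHom)), (η * ((unramifiedTwist F (1 / 2) : QuasiChar F).toMonoidHom)⁻¹)] : Fin 3 → (Fˣ →* ℂˣ)) ((Equiv.swap (0 : Fin 3) 1 * Equiv.swap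 (1 : Fin 3) 2).symm 1),
      (![(η * ((unramifiedTwist F (1 / 2) : QuasiChar F).toMonoidHom)⁻¹), (η * ((unramifiedTwist F (1 / 2) : QuasiChar F).toMonoidHom)), (η * ((unramifiedTwist F (1 / 2) : QuasiChar F).toMonoidHom)⁻¹)] : Fin 3 → (Fˣ →* ℂˣ)) ((Equiv.swap (0 : Fin 3) 1 * Equiv.swap (1 : Fin 3) 2).symm 2)] = (![(η * ((unramifiedTwist F (1 / 2) : QuasiChar F).toMonoidHom)⁻¹), (η * ((unramifiedTwist F (1 / 2) : QuasiChar F).toMonoidHom)⁻¹), (η * ((unramifiedTwist F (1 / 2) : QuasiChar F).toMonoidHom))] : Fin 3 → (Fˣ →* ℂˣ))) := by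
  refine ⟨?_, ?_, ?_⟩
  · funext a; fin_cases a <;> simp [Equiv.Perm.one_def]
  · funext a; fin_cases a <;> simp [Equiv.symm_swap, Equiv.swap_apply_def]
  · funext a; fin_cases a <;> simp [Equiv.Perm.mul_def, Equiv.symm_swap, Equiv.swap_apply_def]

/-- `B ≠ A` as weights (coordinate 1: `a ≠ aν`, ★ REG). [folklore] -/
theorem tch_B_ne_A : (fun m : (Π a : Fin 3, GL {i : Fin 3 // (id : Fin 3 → Fin 3) i = a} F) => (((∏ a : Fin 3, ((![(η * ((unramifiedTwist F (1 / 2) : QuasiChar F).toMonoidHom)⁻¹), (η * ((unramifiedTwist F (1 / 2) : QuasiChar F).toMonoidHom)⁻¹), (η * ((unramifiedTwist F (1 / 2) : QuasiChar F).toMonoidHom))] : Fin 3 → (Fˣ →* ℂˣ)) a).comp (Matrix.GeneralLinearGroup.det.comp (Pi.evalMonoidHom (fun a : Fin 3 => GL {i : Fin 3 // (id : Fin 3 → Fin 3) i = a} F) a))) m : ℂˣ) : ℂ)) ≠ (fun m : (Π a : Fin 3, GL {i : Fin 3 // (id : Fin 3 → Fin 3) i = a} F) => (((∏ a : Fin 3,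 ((![(η * ((unramifiedTwist F (1 / 2) : QuasiChar F).toMonoidHom)⁻¹), (η * ((unramifiedTwist F (1 / 2) : QuasiChar F).toMonoidHom)), (η * ((unramifiedTwist F (1 / 2) : QuasiChar F).toMonoidHom)⁻¹)] : Fin 3 → (Fˣ →* ℂˣ)) a).comp (Matrix.GeneralLinearGroup.det.comp (Pi.evalMonoidHom (fun a : Fin 3 => GL {i : Fin 3 // (id : Fin 3 → Fin 3) i = a} F) a))) m : ℂˣ) : ℂ)) := fun h =>
  mul_nuHalf_inv_ne_mul_nuHalf η (by have h1 := congrFun (eq_of_tch_coe_eq _ _ h) 1; simpa using h1)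

open scoped Classical in
/-- **`E(D♭) = {B², A}`**: `r_U(D♭)` is finite-dimensional and `mult D♭ ζ = 2·[ζ = B] + [ζ = A]` for every `ζ` (★ GEO-QB at `ψ = ην½⁻¹`: the reorderings `w = s₂, s₁s₂` of
`θ_{D♭} = (a,aν,a)` give `B`, `w = 1` gives `A`). [cite: BernsteinZelevinsky1977, §2.12, Thm. 5.2] [cite: Zelevinsky1980, §1.2, Ex. 3.2] -/
theorem finrank_weightSpace_D_low (hη : IsOpen ((η.ker : Subgroup Fˣ) : Set Fˣ)) (ζ : (Π a : Fin 3, GL {i : Fin 3 // (id : Fin 3 → Fin 3) i = a} F) → ℂ) :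
    FiniteDimensional ℂ (restrictUnipotentGL F (id : Fin 3 → Fin 3) (Representation.parabolicIndGL F (![false, false, true] : Fin 3 → Bool) ((Representation.trivial ℂ (Π a : Bool, GL {i : Fin 3 // (![false, false, true] : Fin 3 → Bool) i = a} F) ℂ).twist ((η.comp (Matrix.GeneralLinearGroup.det.comp (Pi.evalMonoidHom (fun a : Bool => GL {i : Fin 3 // (![false, false, true] : Fin 3 → Bool) i = a} F) false))) * ((η * ((unramifiedTwist F (1 / 2) : QuasiChar F).toMonoidHom)⁻¹).comp (Matrix.GeneralLinearGroup.det.comp (Pi.evalMonoidHom (fun a : Bool => GL {i : Fin 3 // (![false, false, true] : Fin 3 → Bool) i = a} F) true))))))).Coinvariants ∧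
    finrank ℂ ↥(⨅ m, Module.End.maxGenEigenspace (Representation.normalizedJacquetGL F (id : Fin 3 → Fin 3) (Representation.parabolicIndGL F (![false, false, true] : Fin 3 → Bool) ((Representation.trivial ℂ (Π a : Bool, GL {i : Fin 3 // (![false, false, true] : Fin 3 → Bool) i = a} F) ℂ).twist ((η.comp (Matrix.GeneralLinearGroup.det.comp (Pi.evalMonoidHom (fun a : Bool => GL {i : Fin 3 // (![false, false, true] : Fin 3 → Bool) i = a} F) false))) * ((η * ((unramifiedTwist F (1 / 2) : QuasiChar F).toMonoidHom)⁻¹).comp (Matrix.GeneralLinearGroup.det.comp (Pi.evalMonoidHom (fun a : Bool => GL {i : Fin 3 // (![false, false, true] : Fin 3 → Bool) i = a} F) true)))))) m) (ζ m)) = (if ζ = (fun m : (Π a : Fin 3, GL {i : Fin 3 // (id : Fin 3 → Fin 3) i = a} F) => (((∏ a : Fin 3, ((![(η * ((unramifiedTwist F (1 / 2) : QuasiChar F).toMonoidHom)⁻¹), (η * ((unramifiedTwist F (1 / 2) : QuasiChar F).toMonoidHom)⁻¹), (η * ((unramifiedTwist F (1 / 2) : QuasiChar F).toMonoidHom))]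 : Fin 3 → (Fˣ →* ℂˣ)) a).comp (Matrix.GeneralLinearGroup.det.comp (Pi.evalMonoidHom (fun a : Fin 3 => GL {i : Fin 3 // (id : Fin 3 → Fin 3) i = a} F) a))) m : ℂˣ) : ℂ)) then 2 else 0) + (if ζ = (fun m : (Π a : Fin 3, GL {i : Fin 3 // (id : Fin 3 → Fin 3) i = a} F) => (((∏ a : Fin 3, ((![(η * ((unramifiedTwist F (1 / 2) : QuasiChar F).toMonoidHom)⁻¹), (η * ((unramifiedTwist F (1 / 2) : QuasiChar F).toMonoidHom)), (η * ((unramifiedTwist F (1 / 2) : QuasiChar F).toMonoidHom)⁻¹)] : Fin 3 → (Fˣ →* ℂˣ)) a).comp (Matrix.GeneralLinearGroup.det.comp (Pi.evalMonoidHom (fun a : Fin 3 => GL {i : Fin 3 // (id : Fin 3 → Fin 3) i = a} F) a))) m : ℂˣ) : ℂ)) then 1 else 0) := by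
  -- `a = ην½⁻¹` has open kernel (= ★ F7a `isOpen_ker_a`, inlined to keep this brick below F7a in the import order)
  have ha : IsOpen ((((η * ((unramifiedTwist F (1 / 2) : QuasiChar F).toMonoidHom)⁻¹)).ker : Subgroup Fˣ) : Set Fˣ) :=
    K2E3GL3StandardModuleEmbedding.isOpen_ker_mul_of_isOpen hη (by rw [K2E3GL3StandardModuleEmbedding.ker_inv_eq_ker]; exact K2E3GL3StandardModuleEmbedding.isOpen_ker_nuHalf)
  have hh := finrank_weightSpace_normalizedJacquetGL_D η (η * ((unramifiedTwist F (1 / 2) : QuasiChar F).toMonoidHom)⁻¹) hη ha ζ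
  refine ⟨hh.1, ?_⟩
  have h := hh.2
  rw [h]
  have h123 := reorder_theta_D_low η
  have h1 := h123.1
  have h2 := h123.2.1
  have h3 := h123.2.2
  have e1 := tch_reorder_eq (![(η * ((unramifiedTwist F (1 / 2) : QuasiChar F).toMonoidHom)⁻¹), (η * ((unramifiedTwist F (1 / 2) : QuasiChar F).toMonoidHom)), (η * ((unramifiedTwist F (1 / 2) : QuasiChar F).toMonoidHom)⁻¹)] : Fin 3 → (Fˣ →* ℂˣ)) (1 : Equiv.Perm (Fin 3))
  have e2 := tch_reorder_eq (![(η * ((unramifiedTwist F (1 / 2) : QuasiChar F).toMonoidHom)⁻¹), (η * ((unramifiedTwist F (1 / 2) : QuasiChar F).toMonoidHom)), (η * ((unramifiedTwist F (1 / 2) : QuasiChar F).toMonoidHom)⁻¹)] : Fin 3 → (Fˣ →* ℂˣ)) (Equiv.swap (1 : Fin 3) 2)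
  have e3 := tch_reorder_eq (![(η * ((unramifiedTwist F (1 / 2) : QuasiChar F).toMonoidHom)⁻¹), (η * ((unramifiedTwist F (1 / 2) : QuasiChar F).toMonoidHom)), (η * ((unramifiedTwist F (1 / 2) : QuasiChar F).toMonoidHom)⁻¹)] : Fin 3 → (Fˣ →* ℂˣ)) (Equiv.swap (0 : Fin 3) 1 * Equiv.swap (1 : Fin 3) 2)
  rw [h1] at e1
  rw [h2] at e2
  rw [h3] at e3
  have hs : Equiv.swap (1 : Fin 3) 2 ≠ Equiv.swap (0 : Fin 3) 1 * Equiv.swap (1 : Fin 3) 2 := by decide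
  have h1s : (1 : Equiv.Perm (Fin 3)) ≠ Equiv.swap (1 : Fin 3) 2 := by decide
  have h1s' : (1 : Equiv.Perm (Fin 3)) ≠ Equiv.swap (0 : Fin 3) 1 * Equiv.swap (1 : Fin 3) 2 := by decide
  have hBA := tch_B_ne_A η
  simp only [Finset.filter_insert, Finset.filter_singleton, e1, e2, e3]
  by_cases hB : ζ = (fun m : (Π a : Fin 3, GL {i : Fin 3 // (id : Fin 3 → Fin 3) i = a} F) => (((∏ a : Fin 3, ((![(η * ((unramifiedTwist F (1 / 2) : QuasiChar F).toMonoidHom)⁻¹), (η * ((unramifiedTwist F (1 / 2) : QuasiChar F).toMonoidHom)⁻¹), (η * ((unramifiedTwist F (1 / 2) : QuasiChar F).toMonoidHom))] : Fin 3 → (Fˣ →* ℂˣ)) a).comp (Matrix.GeneralLinearGroup.det.comp (Pi.evalMonoidHom (fun a : Fin 3 => GL {i : Fin 3 // (id : Fin 3 → Fin 3) i = a} F) a))) m : ℂˣ) : ℂ))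
  · have hA : ¬ ζ = (fun m : (Π a : Fin 3, GL {i : Fin 3 // (id : Fin 3 → Fin 3) i = a} F) => (((∏ a : Fin 3, ((![(η * ((unramifiedTwist F (1 / 2) : QuasiChar F).toMonoidHom)⁻¹), (η * ((unramifiedTwist F (1 / 2) : QuasiChar F).toMonoidHom)), (η * ((unramifiedTwist F (1 / 2) : QuasiChar F).toMonoidHom)⁻¹)] : Fin 3 → (Fˣ →* ℂˣ)) a).comp (Matrix.GeneralLinearGroup.det.comp (Pi.evalMonoidHom (fun a : Fin 3 => GL {i : Fin 3 // (id : Fin 3 → Fin 3) i = a} F) a))) m : ℂˣ) : ℂ)) := fun h' => hBA (hB.symm.trans h')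
    rw [if_neg hA, if_pos hB, if_pos hB, if_pos hB, if_neg hA, Finset.card_insert_of_notMem (by rw [Finset.mem_singleton]; exact hs)]
    simp
  · by_cases hA : ζ = (fun m : (Π a : Fin 3, GL {i : Fin 3 // (id : Fin 3 → Fin 3) i = a} F) => (((∏ a : Fin 3, ((![(η * ((unramifiedTwist F (1 / 2) : QuasiChar F).toMonoidHom)⁻¹), (η * ((unramifiedTwist F (1 / 2) : QuasiChar F).toMonoidHom)), (η * ((unramifiedTwist F (1 / 2) : QuasiChar F).toMonoidHom)⁻¹)] : Fin 3 → (Fˣ →* ℂˣ)) a).comp (Matrix.GeneralLinearGroup.det.comp (Pi.evalMonoidHom (fun a : Fin 3 => GL {i : Fin 3 // (id : Fin 3 → Fin 3) i = a} F) a))) m : ℂˣ) : ℂ))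
    · rw [if_pos hA, if_neg hB, if_neg hB, if_neg hB, if_pos hA]
      simp
    · rw [if_neg hA, if_neg hB, if_neg hB, if_neg hB, if_neg hA]
      simp

end Summit.HodgeConjecture.HodgeConjecture.Cruxes.H413.K2E3GL3OneLinkNestedLowPieces

end
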